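import Summits.QuantumFields.YangMills.Theorems.UnitScaleTiltProp7PcolOfGradientRow
import Summits.QuantumFields.YangMills.Theorems.UnitScaleTiltProp7NestedMeanParallelLift
import Summits.QuantumFields.YangMills.Theorems.UnitScaleTiltProp7TrueLinLineBound
import Summits.QuantumFields.YangMills.Theorems.UnitScaleTiltProp7SectET3RealCoordSums
import HarnessLib

/-!
# Route `UnitScaleTilt`, crux K1 «MinimiserStabilityRegPr» (stmt-QuantumFields-19200), EX face rows `hPcol` ∕ `h88` — **(Z0) THE CURVED ZERO-MODE LEMMA: THE ZERO MODES
# `ker D_{U₀}` ARE ORTHOGONAL TO THE KERNEL OF THE TOP NESTED COVARIANT MEAN `Q″`; HENCE `P₀ ∘ G_a ∘ R_S = 0` AND, UNDER LIFT, `G′ᴾ R_S = G_a R_S` AND `R_S G′ᴾ = R_S G_a`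
# EXACTLY** (★p1 g27 CHAIR LOCATE №26∕№27 (2) — the `P₀` caveat of the h88 door's λ-row and of the κ-weighted hPcol storey «hPcol-κ»; width seat `ym3-torus-px5` gen 13)

Cell `ym3-torus` (HUMAN RULING D-0037; rung R3 = SU(2) YM₃ on T³ — NOT d = 4, NOT infinite volume, NOT a mass gap, NOT Clay).  THEOREMS ONLY (0 `def`, 0 `sorry`, default heartbeats);
`--supports stmt-QuantumFields-19200 --as helper`; count-neutral.

THE POINT.  P1 ✓`Prop7PcolOperatorReduction.GprimeP_RS_eq` reads `G′ᴾ(R_S u) = G_a(R_S u) − P₀(G_a(R_S u))` and P4 ✓`Prop7PcolOfGradientRow.RS_GprimeP_eq` reads `R_S(G′ᴾ g) = R_S(G_a(g − P₀g))`,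
`P₀ = kerDProj U₀` the orthogonal projection onto the zero modes `ker D_{U₀}` (covariantly constant gauge parameters).  In the PLAIN `ℓ¹` column `hPcol` the `P₀` term is harmless
(`Σ_x ‖P₀ν‖ ≤ 3‖ν‖₁`), but in any `e^{κ·tdist}`-WEIGHTED edition (the h88 door's λ-row; «hPcol-κ») it is a zero mode with no decay: the weighted row is K-false unless `P₀(G_a(R_S u)) = 0`.
Since `ν₀ := G_a(R_S u) ∈ ker Q″` (P1 ✓`G_RS_eq_and_mem_ker`), this is the statement **`ker Q″ ⊥ ker D_{U₀}`** — print's «`R` projects onto `Δ^η_U N(Q′)` ⊆ (ker Δ^η_U)^⊥» made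
effective for the penalised propagator.  IT HOLDS for the top nested covariant mean of record (the `hseq`∕`htop` letter of every LOD file): for a `U₀♭`-PARALLEL `λ₀` (⟺ `toL2S λ₀ ∈ ker D_{U₀}`,
the (3.3) stencil ✓`toL2_symm_DL2_toL2S_eq`) and an averaging sequence `ns` of `λ` (recursion (3.19): `ns_{j+1}(y) = mean_i Ad_{Ū⁽ʲ⁾(Γ_{y,i})} ns_j(x_{y,i})`, `x_{y,i}` the block sites), the
BILINEAR block sums `S_j := Σ_{x ∈ T⁽ʲ⁾} tr(λ₀ᴴ(x̂)·ns_j(x))` satisfy `S_{j+1} = L⁻ᵈ·S_j` — trace cyclicity and `Ad_{Ū⁽ʲ⁾(Γ)⁻¹}λ₀ᴴ(ŷ) = λ₀ᴴ(x̂_{y,i})` (✓`parallel_emlIterU`, ✓`conjR_holT_of_parallel`;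
`λ₀ᴴ` is parallel because `U₀♭` is unitary; NO unitarity of the averaged `Ū⁽ʲ⁾` is used) — so a VANISHING top mean forces `S_0 = Σ_x tr(λ₀ᴴλ) = c₀⁻¹⟪toL2S λ₀, toL2S λ⟫ = 0`.

WHAT IS PROVED (ns `Summit.QuantumFields.YangMills.Theorems.Prop7ZeroModesOrthKerTopMean`; the averaging recursion DISPLAYED VERBATIM as the `hseq` letter of P4∕V4∕T1 and the `htop`
letter of ✓`Prop7RSEqPrintProjectorOfLift`):
* §1 `avgStep_eq_mean_transport` (one step of (3.19) as a mean of transported block values), `parallel_conjTranspose`, `conjR_parallel_of_DL2_toL2S_eq_zero` (the `conjR` reading of ✓`Prop7LiftOfRSEqPrintProjector.parallel_of_DL2_toL2S_eq_zero`), `sum_Idx_fst_complex`,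
  ★`trace_mul_avgStep` (one block: `tr(λ₀ᴴ(ŷ)·ns_{j+1}(y)) = |Idx|⁻¹ Σ_i tr(λ₀ᴴ(x̂_{y,i})·ns_j(x_{y,i}))`), ★`sum_trace_avgStep` (`S_{j+1} = L⁻ᵈ S_j`), ★★`sum_trace_avgSeq_eq` (`S_j = L^{−dj} S_0`).
* §2 ★★★`inner_toL2S_eq_zero_of_parallel_of_top_eq_zero` (Z0: parallel `λ₀`, vanishing top mean of `λ` ⟹ `⟪toL2S λ₀, toL2S λ⟫ = 0`); ★★★`kerDProj_eq_zero_of_top_eq_zero`,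
  ★★★`kerDProj_eq_zero_of_Q''_eq_zero` (`hseq` letter: `Q″u = 0 ⟹ P₀u = 0`), `kerDProj_eq_zero_of_Q''_eq_zero_of_htop` (`htop` letter).
* §3 (LOD letters of P1∕P4 displayed: `Q″ ι T hT G hAG hGA hRS hker hseq`) ★★`kerDProj_G_RS_eq_zero` (`P₀(G_a(R_S u)) = 0`), ★★★`GprimeP_RS_eq_G_RS` (`G′ᴾ_{a′}(R_S u) = G_a(R_S u)`,
  every `0 ≤ a′`), `GprimeP_RS_DstarL2_eq_G_RS_DstarL2` (hPcol's operator: `G′ᴾR_SD* = G_aR_SD*`), ★★`RS_G_kerDProj_eq_zero` (`R_S(G_a(P₀g)) = 0`, the adjoint), ★★★`RS_GprimeP_eq_RS_G`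
  (`R_S(G′ᴾ_{a′} g) = R_S(G_a g)`), `DL2_RS_GprimeP_eq_DL2_RS_G` (the gradient row's operator: `D R_S G′ᴾ = D R_S G_a` — P4's `g′ = (1 − P₀)g` bookkeeping is the identity).
HYP-SAT (★★OWNER RULING №42).  `hseq`∕`htop` ⟸ ✓`exists_intertwiner_of_regPr` (the top nested covariant mean of the averaging of record); `hT hAG hGA` ⟸ ✓`exists_massive_inverse`;
`hRS hker` ⟸ ✓`RS_eq_projR_of_lift` under the Lift antecedent; all as in P1∕P4 (inhabited there).  Conclusions are identities for the row's own objects; no estimate, no window.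
HONEST SCOPE.  Linear algebra + the (3.19) bookkeeping; nothing of the λ-row, «hPcol-κ», h88, the ten EX rows, EX `stub_existenceMinimalOrbit` or the crux is proved here; the
Yang–Mills mass gap is NOT proved.

References: T. Bałaban, CMP **99** (1985) 389–434 [Balaban1985BackgroundPropagators] ((3.3) p.391, (3.19)–(3.25) pp.393–394, (3.115)–(3.122) pp.418–420); CMP **98** (1985) 17–51
[Balaban1985Averaging] ((8)–(11) pp.18–19, (97) p.32); CMP **102** (1985) 277–309 [Balaban1985Variational] ((138)–(139) p.299).
-/

set_option autoImplicit false

noncomputable section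

open scoped BigOperators Matrix.Norms.L2Operator InnerProductSpace ComplexConjugate Matrix

namespace Summit.QuantumFields.YangMills.Theorems.Prop7ZeroModesOrthKerTopMean

open Literature.MathematicalPhysics.QuantumFieldTheory.Balaban1983to89
open Literature.MathematicalPhysics.QuantumFieldTheory.Balaban1983to89.T3ContinuumYM3Torus
open T4Continuum BlockAveraging
open BlockAveraging (Idx off)
open B7Prop1Explicit (disp)
open B7Eq78Linearization (conjR conjR_apply)
open B10Eq27TorusAxialLog (holT transl unitsField toUField)
open B7TransferAnalyticMean (meanCLM meanCLM_apply)
open B15DeterminingSets (embIter)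
open B11Eq103H1Complex (SiteL2K BondL2K projR)
open Summit.QuantumFields.YangMills.Theorems.Prop8Chart (emlIterU)
open T3SectALandauChart (eta eta_pos bgUnits)
open T3PrintedRegularOrbits (sites_eq)
open T3LevelShift (siteShift)
open Summit.QuantumFields.YangMills.Theorems.Prop7SectET3Transport (periodsT3)
open Summit.QuantumFields.YangMills.Theorems.Prop7SectET3HilbertLetters (W₂ toL2 toL2S DL2 DstarL2 covLapSite)
open Summit.QuantumFields.YangMills.Theorems.Prop7SectET3GaugeProjector (NS RS RS_isSymmetric)
open Summit.QuantumFields.YangMills.Theorems.Prop7SectET3DeltaPiPInv (kerDProj GprimeP kerDProj_isSymmetric kerDProj_eq_zero_of_mem_orthogonal DL2_kerDProj)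
open Summit.QuantumFields.YangMills.Theorems.Prop7NestedMeanPoincare (conjR_unitsField_toUField)
open Summit.QuantumFields.YangMills.Theorems.Prop7NestedMeanParallelLift (conjR_holT_of_parallel parallel_emlIterU toL2_symm_DL2_toL2S_eq)
open Summit.QuantumFields.YangMills.Theorems.Prop7TrueLinLineBound (sum_site_eq_sum_blockSite)
open Summit.QuantumFields.YangMills.Theorems.Prop7SectET3RealCoordSums (inner_toL2S)
open Summit.QuantumFields.YangMills.Theorems.Prop7PcolOperatorReduction (G_RS_eq_and_mem_ker GprimeP_RS_eq)
open Summit.QuantumFields.YangMills.Theorems.Prop7PcolOfGradientRow (isSymmetric_G RS_GprimeP_eq)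

variable (F : T3Family) {n K : ℕ}

/-! ## §1 One step of the averaging recursion against a parallel section -/

/-- **ONE STEP OF (3.19) AS A MEAN OF TRANSPORTED BLOCK VALUES**: `ns_{j+1}(y) = |Idx|⁻¹ Σ_i Ū⁽ʲ⁾(Γ_{y,i})·ns_j(x_{y,i})·Ū⁽ʲ⁾(Γ_{y,i})⁻¹`, `x_{y,i} = blockSite y i.1`
(✓`transl_emb_disp_stairWord_eq_blockSite`; the two `ns_j(ŷ)` summands of the displayed recursion cancel). [cite: Balaban1985BackgroundPropagators, (3.19) p.393; Balaban1985Averaging, (97) p.32] -/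
theorem avgStep_eq_mean_transport (U₀ : GaugeField (F.P K) 0 (Matrix.specialUnitaryGroup (Fin 2) ℂ))
    (ns : (j : ℕ) → Site (F.P K) j → Matrix (Fin 2) (Fin 2) ℂ)
    (hsucc : ∀ (j : ℕ) (y : Site (F.P K) (j + 1)), ns (j + 1) y = ns j (emb y) - meanCLM (Idx (F.P K)) (Matrix (Fin 2) (Fin 2) ℂ) fun i : Idx (F.P K) =>
        ns j (emb y) - ((holT (emlIterU j (bgUnits F K U₀)) (emb y) (stairWord i.2.1 (off i.1)) : (Matrix (Fin 2) (Fin 2) ℂ)ˣ) : Matrix (Fin 2) (Fin 2) ℂ) *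
          ns j (transl (emb y) (disp (stairWord i.2.1 (off i.1)))) * (((holT (emlIterU j (bgUnits F K U₀)) (emb y) (stairWord i.2.1 (off i.1)))⁻¹ : (Matrix (Fin 2) (Fin 2) ℂ)ˣ) : Matrix (Fin 2) (Fin 2) ℂ))
    (j : ℕ) (y : Site (F.P K) (j + 1)) :
    ns (j + 1) y = (Fintype.card (Idx (F.P K)) : ℂ)⁻¹ • ∑ i : Idx (F.P K),
      ((holT (emlIterU j (bgUnits F K U₀)) (emb y) (stairWord i.2.1 (off i.1)) : (Matrix (Fin 2) (Fin 2) ℂ)ˣ) : Matrix (Fin 2) (Fin 2) ℂ) *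
        ns j (Site.blockSite y i.1) * (((holT (emlIterU j (bgUnits F K U₀)) (emb y) (stairWord i.2.1 (off i.1)))⁻¹ : (Matrix (Fin 2) (Fin 2) ℂ)ˣ) : Matrix (Fin 2) (Fin 2) ℂ) := by
  have hcard : (Fintype.card (Idx (F.P K)) : ℂ) ≠ 0 := Nat.cast_ne_zero.2 Fintype.card_ne_zero
  rw [hsucc, meanCLM_apply]
  simp_rw [Prop7FrameLevelOnto.transl_emb_disp_stairWord_eq_blockSite]
  rw [Finset.sum_sub_distrib, Finset.sum_const, Finset.card_univ, smul_sub, ← Nat.cast_smul_eq_nsmul ℂ, smul_smul, inv_mul_cancel₀ hcard, one_smul,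
    sub_sub_cancel]

/-- **THE CONJUGATE TRANSPOSE OF A `U₀♭`-PARALLEL SECTION IS PARALLEL** (`U₀♭(b)` is unitary: `(U X U⋆)ᴴ = U Xᴴ U⋆`). [cite: Balaban1985Averaging, (8)–(9) pp.18–19] -/
theorem parallel_conjTranspose (U₀ : GaugeField (F.P K) 0 (Matrix.specialUnitaryGroup (Fin 2) ℂ)) (l : Site (F.P K) 0 → Matrix (Fin 2) (Fin 2) ℂ)
    (hpar : ∀ b : PBond (F.P K) 0, conjR (bgUnits F K U₀ b) (l b.tgt) = l b.src) (b : PBond (F.P K) 0) :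
    conjR (bgUnits F K U₀ b) ((l b.tgt)ᴴ) = (l b.src)ᴴ := by
  rw [← hpar b]
  show conjR (unitsField (toUField U₀) b) ((l b.tgt)ᴴ) = (conjR (unitsField (toUField U₀) b) (l b.tgt))ᴴ
  rw [conjR_unitsField_toUField, conjR_unitsField_toUField, Matrix.star_eq_conjTranspose, Matrix.conjTranspose_mul, Matrix.conjTranspose_mul,
    Matrix.conjTranspose_conjTranspose, Matrix.mul_assoc]

/-- **`toL2S λ ∈ ker D_{U₀}` ⟹ `λ` IS `U₀♭`-PARALLEL**, in the `conjR` letters of ✓`conjR_holT_of_parallel` (the (3.3) stencil `η⁻¹•(Ad_{U₀♭(b)}λ(b₊) − λ(b₋))` vanishes, `η ≠ 0`; cousin of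
✓`Prop7LiftOfRSEqPrintProjector.parallel_of_DL2_toL2S_eq_zero`, which reads the same in product letters). [cite: Balaban1985BackgroundPropagators, (3.3) p.391, (3.21) p.394] -/
theorem conjR_parallel_of_DL2_toL2S_eq_zero {c₀ : ℝ} [Fact (0 < c₀)] (U₀ : GaugeField (F.P K) 0 (Matrix.specialUnitaryGroup (Fin 2) ℂ)) (l : Site (F.P K) 0 → Matrix (Fin 2) (Fin 2) ℂ)
    (hl : DL2 F n K c₀ U₀ (toL2S F K c₀ l) = 0) (b : PBond (F.P K) 0) :
    conjR (bgUnits F K U₀ b) (l b.tgt) = l b.src := by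
  have h := congrFun (toL2_symm_DL2_toL2S_eq F (n := n) (c₀ := c₀) U₀ l) b
  rw [hl, map_zero, Pi.zero_apply] at h
  have hη : (((eta F n K : ℝ) : ℂ)⁻¹) ≠ 0 := inv_ne_zero (by exact_mod_cast (eta_pos F n K).ne')
  exact sub_eq_zero.1 ((smul_eq_zero.1 h.symm).resolve_left hη)

/-- A sum over `Idx = offsets × orderings²` of a function of the offset alone (complex values). [cite: Balaban1987RG1, (0.4) p.253 (bookkeeping)] -/
theorem sum_Idx_fst_complex (g : (Fin (F.P K).d → Fin (F.P K).L) → ℂ) :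
    ∑ i : Idx (F.P K), g i.1 = (Fintype.card (Equiv.Perm (Fin (F.P K).d) × Equiv.Perm (Fin (F.P K).d)) : ℂ) * ∑ r : Fin (F.P K).d → Fin (F.P K).L, g r := by
  rw [Fintype.sum_prod_type, Finset.mul_sum]
  refine Finset.sum_congr rfl fun r _ => ?_
  simp only [Finset.sum_const, Finset.card_univ]
  rw [nsmul_eq_mul]

/-- ★ **ONE BLOCK: `tr(λ₀ᴴ(ŷ)·ns_{j+1}(y)) = |Idx|⁻¹ Σ_i tr(λ₀ᴴ(x̂_{y,i})·ns_j(x_{y,i}))`** for a `U₀♭`-parallel `λ₀ᴴ`-type section `l′` (here: any parallel `l′`): the transport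
`Ū⁽ʲ⁾(Γ_{y,i})` moves past `l′(ŷ)` by trace cyclicity and ✓`conjR_holT_of_parallel` ∘ ✓`parallel_emlIterU` (`Ad_{Ū⁽ʲ⁾(Γ_{y,i})} l′(x̂_{y,i}) = l′(ŷ)`, the staircase ending at the block
site, ✓`walkEnd_emb_stairWord_eq_blockSite`). BILINEAR pairing — no unitarity of `Ū⁽ʲ⁾` is used. [cite: Balaban1985BackgroundPropagators, (3.19) p.393; Balaban1985Averaging, (11) p.19, (97) p.32] -/
theorem trace_mul_avgStep (U₀ : GaugeField (F.P K) 0 (Matrix.specialUnitaryGroup (Fin 2) ℂ))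
    (l' : Site (F.P K) 0 → Matrix (Fin 2) (Fin 2) ℂ) (hpar : ∀ b : PBond (F.P K) 0, conjR (bgUnits F K U₀ b) (l' b.tgt) = l' b.src)
    (ns : (j : ℕ) → Site (F.P K) j → Matrix (Fin 2) (Fin 2) ℂ)
    (hsucc : ∀ (j : ℕ) (y : Site (F.P K) (j + 1)), ns (j + 1) y = ns j (emb y) - meanCLM (Idx (F.P K)) (Matrix (Fin 2) (Fin 2) ℂ) fun i : Idx (F.P K) =>
        ns j (emb y) - ((holT (emlIterU j (bgUnits F K U₀)) (emb y) (stairWord i.2.1 (off i.1)) : (Matrix (Fin 2) (Fin 2) ℂ)ˣ) : Matrix (Fin 2) (Fin 2) ℂ) *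
          ns j (transl (emb y) (disp (stairWord i.2.1 (off i.1)))) * (((holT (emlIterU j (bgUnits F K U₀)) (emb y) (stairWord i.2.1 (off i.1)))⁻¹ : (Matrix (Fin 2) (Fin 2) ℂ)ˣ) : Matrix (Fin 2) (Fin 2) ℂ))
    (j : ℕ) (y : Site (F.P K) (j + 1)) :
    Matrix.trace (l' (embIter (j + 1) y) * ns (j + 1) y)
      = (Fintype.card (Idx (F.P K)) : ℂ)⁻¹ * ∑ i : Idx (F.P K), Matrix.trace (l' (embIter j (Site.blockSite y i.1)) * ns j (Site.blockSite y i.1)) := by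
  rw [avgStep_eq_mean_transport F U₀ ns hsucc j y, Matrix.mul_smul, Matrix.trace_smul, smul_eq_mul]
  congr 1
  rw [Finset.mul_sum, Matrix.trace_sum]
  refine Finset.sum_congr rfl fun i _ => ?_
  set Tm : (Matrix (Fin 2) (Fin 2) ℂ)ˣ := holT (emlIterU j (bgUnits F K U₀)) (emb y) (stairWord i.2.1 (off i.1)) with hTm
  have ht := conjR_holT_of_parallel (emlIterU j (bgUnits F K U₀)) (fun z => l' (embIter j z)) (parallel_emlIterU (bgUnits F K U₀) l' hpar j)
    (stairWord i.2.1 (off i.1)) (emb y)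
  rw [BlockAveragingEMLLinearised.walkEnd_emb_stairWord_eq_blockSite, conjR_apply, ← hTm] at ht
  have hl : l' (embIter (j + 1) y) = (Tm : Matrix (Fin 2) (Fin 2) ℂ) * l' (embIter j (Site.blockSite y i.1)) * ((Tm⁻¹ : (Matrix (Fin 2) (Fin 2) ℂ)ˣ) : Matrix (Fin 2) (Fin 2) ℂ) :=
    ht.symm
  rw [hl]
  have hprod : (Tm : Matrix (Fin 2) (Fin 2) ℂ) * l' (embIter j (Site.blockSite y i.1)) * ((Tm⁻¹ : (Matrix (Fin 2) (Fin 2) ℂ)ˣ) : Matrix (Fin 2) (Fin 2) ℂ) *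
      ((Tm : Matrix (Fin 2) (Fin 2) ℂ) * ns j (Site.blockSite y i.1) * ((Tm⁻¹ : (Matrix (Fin 2) (Fin 2) ℂ)ˣ) : Matrix (Fin 2) (Fin 2) ℂ))
      = (Tm : Matrix (Fin 2) (Fin 2) ℂ) * (l' (embIter j (Site.blockSite y i.1)) * ns j (Site.blockSite y i.1)) * ((Tm⁻¹ : (Matrix (Fin 2) (Fin 2) ℂ)ˣ) : Matrix (Fin 2) (Fin 2) ℂ) := by
    simp only [Matrix.mul_assoc, Units.inv_mul_cancel_left]
  rw [hprod, Matrix.trace_mul_cycle, Units.inv_mul, Matrix.one_mul]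

/-- ★ **ONE LEVEL: `S_{j+1} = L⁻ᵈ·S_j`** for the block sums `S_j = Σ_{x ∈ T⁽ʲ⁾} tr(l′(x̂)·ns_j(x))` (§1 per block; `Σ_y Σ_i f(x_{y,i}) = |orderings²|·Σ_x f(x)`, ✓`sum_site_eq_sum_blockSite`;
`|Idx| = Lᵈ·|orderings²|`). [cite: Balaban1985BackgroundPropagators, (3.19) p.393; Balaban1987RG1, (0.3)–(0.4) pp.252–253] -/
theorem sum_trace_avgStep (U₀ : GaugeField (F.P K) 0 (Matrix.specialUnitaryGroup (Fin 2) ℂ))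
    (l' : Site (F.P K) 0 → Matrix (Fin 2) (Fin 2) ℂ) (hpar : ∀ b : PBond (F.P K) 0, conjR (bgUnits F K U₀ b) (l' b.tgt) = l' b.src)
    (ns : (j : ℕ) → Site (F.P K) j → Matrix (Fin 2) (Fin 2) ℂ)
    (hsucc : ∀ (j : ℕ) (y : Site (F.P K) (j + 1)), ns (j + 1) y = ns j (emb y) - meanCLM (Idx (F.P K)) (Matrix (Fin 2) (Fin 2) ℂ) fun i : Idx (F.P K) =>
        ns j (emb y) - ((holT (emlIterU j (bgUnits F K U₀)) (emb y) (stairWord i.2.1 (off i.1)) : (Matrix (Fin 2) (Fin 2) ℂ)ˣ) : Matrix (Fin 2) (Fin 2) ℂ) *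
          ns j (transl (emb y) (disp (stairWord i.2.1 (off i.1)))) * (((holT (emlIterU j (bgUnits F K U₀)) (emb y) (stairWord i.2.1 (off i.1)))⁻¹ : (Matrix (Fin 2) (Fin 2) ℂ)ˣ) : Matrix (Fin 2) (Fin 2) ℂ))
    {j : ℕ} (hj : j + 1 ≤ (F.P K).m + (F.P K).K) :
    ∑ y : Site (F.P K) (j + 1), Matrix.trace (l' (embIter (j + 1) y) * ns (j + 1) y)
      = ((((F.P K).L : ℂ) ^ (F.P K).d)⁻¹) * ∑ x : Site (F.P K) j, Matrix.trace (l' (embIter j x) * ns j x) := by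
  have hperm : (Fintype.card (Equiv.Perm (Fin (F.P K).d) × Equiv.Perm (Fin (F.P K).d)) : ℂ) ≠ 0 := Nat.cast_ne_zero.2 Fintype.card_ne_zero
  have hcard : (Fintype.card (Idx (F.P K)) : ℂ) = ((F.P K).L : ℂ) ^ (F.P K).d * (Fintype.card (Equiv.Perm (Fin (F.P K).d) × Equiv.Perm (Fin (F.P K).d)) : ℂ) := by
    simp only [Idx, Fintype.card_prod, Fintype.card_fun, Fintype.card_fin]
    push_cast
    ring
  simp_rw [trace_mul_avgStep F U₀ l' hpar ns hsucc j]
  rw [← Finset.mul_sum]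
  have hIdx : ∀ y : Site (F.P K) (j + 1), ∑ i : Idx (F.P K), Matrix.trace (l' (embIter j (Site.blockSite y i.1)) * ns j (Site.blockSite y i.1))
      = (Fintype.card (Equiv.Perm (Fin (F.P K).d) × Equiv.Perm (Fin (F.P K).d)) : ℂ) *
          ∑ r : Fin (F.P K).d → Fin (F.P K).L, Matrix.trace (l' (embIter j (Site.blockSite y r)) * ns j (Site.blockSite y r)) :=
    fun y => sum_Idx_fst_complex F (fun r => Matrix.trace (l' (embIter j (Site.blockSite y r)) * ns j (Site.blockSite y r)))
  simp_rw [hIdx]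
  rw [← Finset.mul_sum, ← sum_site_eq_sum_blockSite hj (fun x => Matrix.trace (l' (embIter j x) * ns j x)), ← mul_assoc, hcard, mul_inv, mul_assoc, mul_assoc,
    inv_mul_cancel_left₀ hperm]

/-- ★★ **ALL LEVELS: `S_j = L^{−d·j}·S_0`** (induction on `j ≤ m + K`). [cite: Balaban1985BackgroundPropagators, (3.19) p.393; Balaban1985Averaging, (97) p.32] -/
theorem sum_trace_avgSeq_eq (U₀ : GaugeField (F.P K) 0 (Matrix.specialUnitaryGroup (Fin 2) ℂ))
    (l' : Site (F.P K) 0 → Matrix (Fin 2) (Fin 2) ℂ) (hpar : ∀ b : PBond (F.P K) 0, conjR (bgUnits F K U₀ b) (l' b.tgt) = l' b.src)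
    (ns : (j : ℕ) → Site (F.P K) j → Matrix (Fin 2) (Fin 2) ℂ)
    (hsucc : ∀ (j : ℕ) (y : Site (F.P K) (j + 1)), ns (j + 1) y = ns j (emb y) - meanCLM (Idx (F.P K)) (Matrix (Fin 2) (Fin 2) ℂ) fun i : Idx (F.P K) =>
        ns j (emb y) - ((holT (emlIterU j (bgUnits F K U₀)) (emb y) (stairWord i.2.1 (off i.1)) : (Matrix (Fin 2) (Fin 2) ℂ)ˣ) : Matrix (Fin 2) (Fin 2) ℂ) *
          ns j (transl (emb y) (disp (stairWord i.2.1 (off i.1)))) * (((holT (emlIterU j (bgUnits F K U₀)) (emb y) (stairWord i.2.1 (off i.1)))⁻¹ : (Matrix (Fin 2) (Fin 2) ℂ)ˣ) : Matrix (Fin 2) (Fin 2) ℂ)) :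
    ∀ {j : ℕ}, j ≤ (F.P K).m + (F.P K).K →
      ∑ x : Site (F.P K) j, Matrix.trace (l' (embIter j x) * ns j x)
        = ((((F.P K).L : ℂ) ^ (F.P K).d)⁻¹) ^ j * ∑ x : Site (F.P K) 0, Matrix.trace (l' x * ns 0 x)
  | 0, _ => by rw [pow_zero, one_mul]; rfl
  | j + 1, hj => by
    rw [sum_trace_avgStep F U₀ l' hpar ns hsucc hj, sum_trace_avgSeq_eq U₀ l' hpar ns hsucc (Nat.le_of_succ_le hj), ← mul_assoc, pow_succ']

/-! ## §2 (Z0): `ker Q″ ⊥ ker D_{U₀}` -/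

/-- ★★★ **(Z0) THE CURVED ZERO-MODE LEMMA**: if `λ₀` is `U₀♭`-parallel (⟺ `toL2S λ₀ ∈ ker D_{U₀}`) and `λ` has an averaging sequence (recursion (3.19) with the transports of the
iterated averaged background `Ū⁽ʲ⁾ = emlIterU j U₀♭`) whose TOP MEAN VANISHES at level `K − n`, then `⟪toL2S λ₀, toL2S λ⟫ = 0` — the zero modes are visible to the top nested
covariant mean.  (`⟪toL2S λ₀, toL2S λ⟫ = c₀·S_0` with `l′ := λ₀ᴴ` parallel, and `S_0 = L^{d(K−n)}·S_{K−n} = 0` by §1.) [cite: Balaban1985BackgroundPropagators, (3.19)–(3.21) pp.393–394, (3.115) p.418; Balaban1985Averaging, (97) p.32] -/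
theorem inner_toL2S_eq_zero_of_parallel_of_top_eq_zero (hnK : n ≤ K) {c₀ : ℝ} [Fact (0 < c₀)] (U₀ : GaugeField (F.P K) 0 (Matrix.specialUnitaryGroup (Fin 2) ℂ))
    (l₀ lam : Site (F.P K) 0 → Matrix (Fin 2) (Fin 2) ℂ) (hpar : ∀ b : PBond (F.P K) 0, conjR (bgUnits F K U₀ b) (l₀ b.tgt) = l₀ b.src)
    (ns : (j : ℕ) → Site (F.P K) j → Matrix (Fin 2) (Fin 2) ℂ) (h0 : ns 0 = lam)
    (hsucc : ∀ (j : ℕ) (y : Site (F.P K) (j + 1)), ns (j + 1) y = ns j (emb y) - meanCLM (Idx (F.P K)) (Matrix (Fin 2) (Fin 2) ℂ) fun i : Idx (F.P K) =>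
        ns j (emb y) - ((holT (emlIterU j (bgUnits F K U₀)) (emb y) (stairWord i.2.1 (off i.1)) : (Matrix (Fin 2) (Fin 2) ℂ)ˣ) : Matrix (Fin 2) (Fin 2) ℂ) *
          ns j (transl (emb y) (disp (stairWord i.2.1 (off i.1)))) * (((holT (emlIterU j (bgUnits F K U₀)) (emb y) (stairWord i.2.1 (off i.1)))⁻¹ : (Matrix (Fin 2) (Fin 2) ℂ)ˣ) : Matrix (Fin 2) (Fin 2) ℂ))
    (htop0 : ∀ y : Site (F.P K) (K - n), ns (K - n) y = 0) :
    ⟪toL2S F K c₀ l₀, toL2S F K c₀ lam⟫_ℂ = 0 := by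
  have hk : K - n ≤ (F.P K).m + (F.P K).K := by show K - n ≤ F.m + K; omega
  have key := sum_trace_avgSeq_eq F U₀ (fun x => (l₀ x)ᴴ) (parallel_conjTranspose F U₀ l₀ hpar) ns hsucc hk
  have htop : ∑ x : Site (F.P K) (K - n), Matrix.trace ((fun x => (l₀ x)ᴴ) (embIter (K - n) x) * ns (K - n) x) = 0 :=
    Finset.sum_eq_zero fun x _ => by rw [htop0 x, Matrix.mul_zero, Matrix.trace_zero]
  rw [htop] at key
  have hL : (((((F.P K).L : ℂ) ^ (F.P K).d)⁻¹) ^ (K - n)) ≠ 0 :=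
    pow_ne_zero _ (inv_ne_zero (pow_ne_zero _ (Nat.cast_ne_zero.2 (F.P K).L_pos.ne')))
  have h00 : ∑ x : Site (F.P K) 0, Matrix.trace ((l₀ x)ᴴ * ns 0 x) = 0 := (mul_eq_zero.1 key.symm).resolve_left hL
  rw [h0] at h00
  rw [inner_toL2S, h00, mul_zero]

/-- ★★★ **`P₀ u = 0` WHENEVER `u` HAS AN AVERAGING SEQUENCE WITH VANISHING TOP MEAN** (`P₀ = kerDProj U₀`, the orthogonal projection onto `ker D_{U₀}`): every `k ∈ ker D_{U₀}` is
`toL2S λ₀` with `λ₀` parallel (`conjR_parallel_of_DL2_toL2S_eq_zero`), and (Z0). [cite: Balaban1985BackgroundPropagators, (3.21)–(3.24) p.394] -/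
theorem kerDProj_eq_zero_of_top_eq_zero (hnK : n ≤ K) {c₀ : ℝ} [Fact (0 < c₀)] (U₀ : GaugeField (F.P K) 0 (Matrix.specialUnitaryGroup (Fin 2) ℂ))
    (u : SiteL2K ℂ 3 (periodsT3 F K) c₀ W₂)
    (ns : (j : ℕ) → Site (F.P K) j → Matrix (Fin 2) (Fin 2) ℂ) (h0 : ns 0 = (toL2S F K c₀).symm u)
    (hsucc : ∀ (j : ℕ) (y : Site (F.P K) (j + 1)), ns (j + 1) y = ns j (emb y) - meanCLM (Idx (F.P K)) (Matrix (Fin 2) (Fin 2) ℂ) fun i : Idx (F.P K) =>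
        ns j (emb y) - ((holT (emlIterU j (bgUnits F K U₀)) (emb y) (stairWord i.2.1 (off i.1)) : (Matrix (Fin 2) (Fin 2) ℂ)ˣ) : Matrix (Fin 2) (Fin 2) ℂ) *
          ns j (transl (emb y) (disp (stairWord i.2.1 (off i.1)))) * (((holT (emlIterU j (bgUnits F K U₀)) (emb y) (stairWord i.2.1 (off i.1)))⁻¹ : (Matrix (Fin 2) (Fin 2) ℂ)ˣ) : Matrix (Fin 2) (Fin 2) ℂ))
    (htop0 : ∀ y : Site (F.P K) (K - n), ns (K - n) y = 0) :
    kerDProj F n K c₀ U₀ u = 0 := by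
  refine kerDProj_eq_zero_of_mem_orthogonal U₀ ((Submodule.mem_orthogonal _ _).2 fun k hk => ?_)
  obtain ⟨l₀, rfl⟩ : ∃ l₀ : Site (F.P K) 0 → Matrix (Fin 2) (Fin 2) ℂ, toL2S F K c₀ l₀ = k := ⟨(toL2S F K c₀).symm k, LinearEquiv.apply_symm_apply _ _⟩
  have hu : toL2S F K c₀ ((toL2S F K c₀).symm u) = u := LinearEquiv.apply_symm_apply _ _
  rw [← hu]
  exact inner_toL2S_eq_zero_of_parallel_of_top_eq_zero F hnK U₀ l₀ _ (conjR_parallel_of_DL2_toL2S_eq_zero F U₀ l₀ (LinearMap.mem_ker.1 hk)) ns h0 hsucc htop0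

/-- ★★★ **`Q″u = 0 ⟹ P₀u = 0` — `ker Q″ ⊥ ker D_{U₀}`** for the top nested covariant mean `Q″` of the averaging of record, through its `hseq` letter (the letter of P4∕V4∕T1:
every `λ` has an averaging sequence with top `Q″(toL2S λ)`). [cite: Balaban1985BackgroundPropagators, (3.19)–(3.24) pp.393–394, (3.115) p.418] -/
theorem kerDProj_eq_zero_of_Q''_eq_zero (hnK : n ≤ K) {c₀ : ℝ} [Fact (0 < c₀)] (U₀ : GaugeField (F.P K) 0 (Matrix.specialUnitaryGroup (Fin 2) ℂ))
    (Q'' : SiteL2K ℂ 3 (periodsT3 F K) c₀ W₂ →ₗ[ℂ] (Site (F.P K) (K - n) → Matrix (Fin 2) (Fin 2) ℂ))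
    (hseq : ∀ lam : Site (F.P K) 0 → Matrix (Fin 2) (Fin 2) ℂ, ∃ ns : (j : ℕ) → Site (F.P K) j → Matrix (Fin 2) (Fin 2) ℂ, ns 0 = lam ∧
      (∀ (j : ℕ) (y : Site (F.P K) (j + 1)), ns (j + 1) y = ns j (emb y) - meanCLM (Idx (F.P K)) (Matrix (Fin 2) (Fin 2) ℂ) fun i : Idx (F.P K) =>
        ns j (emb y) - ((holT (emlIterU j (bgUnits F K U₀)) (emb y) (stairWord i.2.1 (off i.1)) : (Matrix (Fin 2) (Fin 2) ℂ)ˣ) : Matrix (Fin 2) (Fin 2) ℂ) *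
          ns j (transl (emb y) (disp (stairWord i.2.1 (off i.1)))) * (((holT (emlIterU j (bgUnits F K U₀)) (emb y) (stairWord i.2.1 (off i.1)))⁻¹ : (Matrix (Fin 2) (Fin 2) ℂ)ˣ) : Matrix (Fin 2) (Fin 2) ℂ)) ∧
      ns (K - n) = Q'' (toL2S F K c₀ lam))
    (u : SiteL2K ℂ 3 (periodsT3 F K) c₀ W₂) (hQ : Q'' u = 0) :
    kerDProj F n K c₀ U₀ u = 0 := by
  obtain ⟨ns, h0, hsucc, htop⟩ := hseq ((toL2S F K c₀).symm u)
  refine kerDProj_eq_zero_of_top_eq_zero F hnK U₀ u ns h0 hsucc fun y => ?_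
  rw [htop, LinearEquiv.apply_symm_apply, hQ]
  rfl

/-- **THE SAME THROUGH THE `htop` LETTER** of ✓`Prop7RSEqPrintProjectorOfLift.RS_eq_projR_of_lift` (any averaging sequence has top `Q″(toL2S λ)`; an averaging sequence always exists —
the recursion defines it). [cite: Balaban1985BackgroundPropagators, (3.19)–(3.24) pp.393–394] -/
theorem kerDProj_eq_zero_of_Q''_eq_zero_of_htop (hnK : n ≤ K) {c₀ : ℝ} [Fact (0 < c₀)] (U₀ : GaugeField (F.P K) 0 (Matrix.specialUnitaryGroup (Fin 2) ℂ))
    (Q'' : SiteL2K ℂ 3 (periodsT3 F K) c₀ W₂ →ₗ[ℂ] (Site (F.P K) (K - n) → Matrix (Fin 2) (Fin 2) ℂ))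
    (htop : ∀ (lam : Site (F.P K) 0 → Matrix (Fin 2) (Fin 2) ℂ) (ns : (j : ℕ) → Site (F.P K) j → Matrix (Fin 2) (Fin 2) ℂ), ns 0 = lam →
      (∀ (j : ℕ) (y : Site (F.P K) (j + 1)), ns (j + 1) y = ns j (emb y) - meanCLM (Idx (F.P K)) (Matrix (Fin 2) (Fin 2) ℂ) fun i : Idx (F.P K) =>
        ns j (emb y) - ((holT (emlIterU j (bgUnits F K U₀)) (emb y) (stairWord i.2.1 (off i.1)) : (Matrix (Fin 2) (Fin 2) ℂ)ˣ) : Matrix (Fin 2) (Fin 2) ℂ) *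
          ns j (transl (emb y) (disp (stairWord i.2.1 (off i.1)))) * (((holT (emlIterU j (bgUnits F K U₀)) (emb y) (stairWord i.2.1 (off i.1)))⁻¹ : (Matrix (Fin 2) (Fin 2) ℂ)ˣ) : Matrix (Fin 2) (Fin 2) ℂ)) →
      ns (K - n) = Q'' (toL2S F K c₀ lam))
    (u : SiteL2K ℂ 3 (periodsT3 F K) c₀ W₂) (hQ : Q'' u = 0) :
    kerDProj F n K c₀ U₀ u = 0 := by
  -- the averaging sequence of `λ := toL2S⁻¹ u`, defined by the recursion itself
  let ns : (j : ℕ) → Site (F.P K) j → Matrix (Fin 2) (Fin 2) ℂ := fun j =>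
    Nat.rec (motive := fun j => Site (F.P K) j → Matrix (Fin 2) (Fin 2) ℂ) ((toL2S F K c₀).symm u)
      (fun j nsj y => nsj (emb y) - meanCLM (Idx (F.P K)) (Matrix (Fin 2) (Fin 2) ℂ) fun i : Idx (F.P K) =>
        nsj (emb y) - ((holT (emlIterU j (bgUnits F K U₀)) (emb y) (stairWord i.2.1 (off i.1)) : (Matrix (Fin 2) (Fin 2) ℂ)ˣ) : Matrix (Fin 2) (Fin 2) ℂ) *
          nsj (transl (emb y) (disp (stairWord i.2.1 (off i.1)))) * (((holT (emlIterU j (bgUnits F K U₀)) (emb y) (stairWord i.2.1 (off i.1)))⁻¹ : (Matrix (Fin 2) (Fin 2) ℂ)ˣ) : Matrix (Fin 2) (Fin 2) ℂ)) j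
  have h0 : ns 0 = (toL2S F K c₀).symm u := rfl
  have hsucc : ∀ (j : ℕ) (y : Site (F.P K) (j + 1)), ns (j + 1) y = ns j (emb y) - meanCLM (Idx (F.P K)) (Matrix (Fin 2) (Fin 2) ℂ) fun i : Idx (F.P K) =>
      ns j (emb y) - ((holT (emlIterU j (bgUnits F K U₀)) (emb y) (stairWord i.2.1 (off i.1)) : (Matrix (Fin 2) (Fin 2) ℂ)ˣ) : Matrix (Fin 2) (Fin 2) ℂ) *
        ns j (transl (emb y) (disp (stairWord i.2.1 (off i.1)))) * (((holT (emlIterU j (bgUnits F K U₀)) (emb y) (stairWord i.2.1 (off i.1)))⁻¹ : (Matrix (Fin 2) (Fin 2) ℂ)ˣ) : Matrix (Fin 2) (Fin 2) ℂ) :=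
    fun _ _ => rfl
  refine kerDProj_eq_zero_of_top_eq_zero F hnK U₀ u ns h0 hsucc fun y => ?_
  rw [htop ((toL2S F K c₀).symm u) ns h0 hsucc, LinearEquiv.apply_symm_apply, hQ]
  rfl

/-! ## §3 Consequences for the LOD propagator and print's `G′ᴾ` under Lift -/

section LOD

variable (hnK : n ≤ K) {c₀ c₁ cB : ℝ} [Fact (0 < c₀)] [Fact (0 < c₁)] [Fact (0 < cB)]
  (U₀ : GaugeField (F.P K) 0 (Matrix.specialUnitaryGroup (Fin 2) ℂ))
  (Q'' : SiteL2K ℂ 3 (periodsT3 F K) c₀ W₂ →ₗ[ℂ] (Site (F.P K) (K - n) → Matrix (Fin 2) (Fin 2) ℂ))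
  (hseq : ∀ lam : Site (F.P K) 0 → Matrix (Fin 2) (Fin 2) ℂ, ∃ ns : (j : ℕ) → Site (F.P K) j → Matrix (Fin 2) (Fin 2) ℂ, ns 0 = lam ∧
      (∀ (j : ℕ) (y : Site (F.P K) (j + 1)), ns (j + 1) y = ns j (emb y) - meanCLM (Idx (F.P K)) (Matrix (Fin 2) (Fin 2) ℂ) fun i : Idx (F.P K) =>
        ns j (emb y) - ((holT (emlIterU j (bgUnits F K U₀)) (emb y) (stairWord i.2.1 (off i.1)) : (Matrix (Fin 2) (Fin 2) ℂ)ˣ) : Matrix (Fin 2) (Fin 2) ℂ) *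
          ns j (transl (emb y) (disp (stairWord i.2.1 (off i.1)))) * (((holT (emlIterU j (bgUnits F K U₀)) (emb y) (stairWord i.2.1 (off i.1)))⁻¹ : (Matrix (Fin 2) (Fin 2) ℂ)ˣ) : Matrix (Fin 2) (Fin 2) ℂ)) ∧
      ns (K - n) = Q'' (toL2S F K c₀ lam))
  (ι : (Site (F.P K) (K - n) → Matrix (Fin 2) (Fin 2) ℂ) →ₗ[ℂ] SiteL2K ℂ 3 (periodsT3 F n) c₁ W₂)
  (T : SiteL2K ℂ 3 (periodsT3 F n) c₁ W₂ →ₗ[ℂ] SiteL2K ℂ 3 (periodsT3 F K) c₀ W₂)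
  (hT : ∀ (l : SiteL2K ℂ 3 (periodsT3 F K) c₀ W₂) (f : SiteL2K ℂ 3 (periodsT3 F n) c₁ W₂), ⟪ι (Q'' l), f⟫_ℂ = ⟪l, T f⟫_ℂ)
  {a : ℝ}
  (G : SiteL2K ℂ 3 (periodsT3 F K) c₀ W₂ →ₗ[ℂ] SiteL2K ℂ 3 (periodsT3 F K) c₀ W₂)
  (hAG : ∀ f, covLapSite F n K c₀ U₀ (G f) + (a : ℂ) • T (ι (Q'' (G f))) = f)
  (hGA : ∀ u, G (covLapSite F n K c₀ U₀ u + (a : ℂ) • T (ι (Q'' u))) = u)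
  (hRS : RS F n K hnK c₀ cB U₀ = projR (covLapSite F n K c₀ U₀) Q'')
  (hker : LinearMap.ker Q'' ≤ NS F n K hnK c₀ cB U₀)

include hseq hGA hRS in
omit [Fact (0 < c₁)] [Fact (0 < cB)] in
/-- ★★ **`P₀(G_a(R_S u)) = 0`**: `G_a(R_S u) ∈ ker Q″` (P1 ✓`G_RS_eq_and_mem_ker`) and `ker Q″ ⊥ ker D_{U₀}` (§2). [cite: Balaban1985BackgroundPropagators, (3.21)–(3.25) p.394, (3.118) p.419] -/
theorem kerDProj_G_RS_eq_zero (u : SiteL2K ℂ 3 (periodsT3 F K) c₀ W₂) :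
    kerDProj F n K c₀ U₀ (G (RS F n K hnK c₀ cB U₀ u)) = 0 :=
  kerDProj_eq_zero_of_Q''_eq_zero F hnK U₀ Q'' hseq _ (G_RS_eq_and_mem_ker F hnK U₀ Q'' ι T G hGA hRS u).1

include hseq hGA hRS hker in
omit [Fact (0 < c₁)] in
/-- ★★★ **UNDER LIFT, `G′ᴾ_{a′}(R_S u) = G_a(R_S u)` EXACTLY**, for every site field `u` and every `0 ≤ a′` (P1 ✓`GprimeP_RS_eq` minus its `P₀` term, which vanishes by
★★`kerDProj_G_RS_eq_zero`). [cite: Balaban1985BackgroundPropagators, (3.25) p.394, (3.118)–(3.122) pp.419–420] -/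
theorem GprimeP_RS_eq_G_RS {a' : ℝ} (ha' : 0 ≤ a') (u : SiteL2K ℂ 3 (periodsT3 F K) c₀ W₂) :
    GprimeP F n K hnK c₀ cB a' U₀ (RS F n K hnK c₀ cB U₀ u) = G (RS F n K hnK c₀ cB U₀ u) := by
  rw [GprimeP_RS_eq F hnK U₀ Q'' ι T G hGA hRS hker ha', kerDProj_G_RS_eq_zero F hnK U₀ Q'' hseq ι T G hGA hRS u, sub_zero]

include hseq hGA hRS hker in
omit [Fact (0 < c₁)] in
/-- **hPcol's OPERATOR WITHOUT `P₀`**: `G′ᴾ_{a′}(R_S(D*_{U₀} w)) = G_a(R_S(D*_{U₀} w))` for every vector field `w`. [cite: Balaban1985BackgroundPropagators, (3.25) p.394; Balaban1985Variational, (139) p.299] -/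
theorem GprimeP_RS_DstarL2_eq_G_RS_DstarL2 {a' : ℝ} (ha' : 0 ≤ a') (w : BondL2K ℂ 3 (periodsT3 F K) c₀ W₂) :
    GprimeP F n K hnK c₀ cB a' U₀ (RS F n K hnK c₀ cB U₀ (DstarL2 F n K c₀ U₀ w)) = G (RS F n K hnK c₀ cB U₀ (DstarL2 F n K c₀ U₀ w)) :=
  GprimeP_RS_eq_G_RS F hnK U₀ Q'' hseq ι T G hGA hRS hker ha' _

include hseq hT hAG hGA hRS in
omit [Fact (0 < cB)] in
/-- ★★ **THE ADJOINT: `R_S(G_a(P₀ g)) = 0`** for every `g` (`R_S`, `G_a`, `P₀` symmetric — ✓`RS_isSymmetric`, ✓`isSymmetric_G`, ✓`kerDProj_isSymmetric` — and ★★`kerDProj_G_RS_eq_zero`).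
[cite: Balaban1985BackgroundPropagators, (3.21)–(3.25) p.394] -/
theorem RS_G_kerDProj_eq_zero (g : SiteL2K ℂ 3 (periodsT3 F K) c₀ W₂) :
    RS F n K hnK c₀ cB U₀ (G (kerDProj F n K c₀ U₀ g)) = 0 := by
  have hRSs : (RS F n K hnK c₀ cB U₀).IsSymmetric := RS_isSymmetric U₀
  have hP0s : (kerDProj F n K c₀ U₀).IsSymmetric := kerDProj_isSymmetric U₀
  have hGs : G.IsSymmetric := isSymmetric_G F U₀ Q'' ι T hT G hAG
  refine ext_inner_right ℂ fun v => ?_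
  rw [hRSs, hGs, hP0s, kerDProj_G_RS_eq_zero F hnK U₀ Q'' hseq ι T G hGA hRS v, inner_zero_right, inner_zero_left]

include hseq hT hAG hGA hRS hker in
/-- ★★★ **UNDER LIFT, `R_S(G′ᴾ_{a′} g) = R_S(G_a g)` EXACTLY**, for every site field `g` and every `0 ≤ a′` (P4 ✓`RS_GprimeP_eq` minus `R_S(G_a(P₀g)) = 0`): P4's
`g′ = (1 − P₀)g` bookkeeping is the identity. [cite: Balaban1985BackgroundPropagators, (3.21)–(3.25) p.394, (3.118)–(3.122) pp.419–420] -/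
theorem RS_GprimeP_eq_RS_G {a' : ℝ} (ha' : 0 ≤ a') (g : SiteL2K ℂ 3 (periodsT3 F K) c₀ W₂) :
    RS F n K hnK c₀ cB U₀ (GprimeP F n K hnK c₀ cB a' U₀ g) = RS F n K hnK c₀ cB U₀ (G g) := by
  rw [RS_GprimeP_eq F hnK U₀ Q'' ι T hT G hAG hGA hRS hker ha' g, map_sub, map_sub, RS_G_kerDProj_eq_zero F hnK U₀ Q'' hseq ι T hT G hAG hGA hRS g, sub_zero]

include hseq hT hAG hGA hRS hker in
/-- **THE GRADIENT ROW's OPERATOR WITHOUT `P₀`**: `D_{U₀}(R_S(G′ᴾ_{a′} g)) = D_{U₀}(R_S(G_a g))` — the `ℓ^∞ → ℓ^∞` row letter `hrow` of P4a∕P4 is a letter for `D R_S G_a` itself.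
[cite: Balaban1985BackgroundPropagators, Thm 3.1 (3.42) p.397, (3.25) p.394] -/
theorem DL2_RS_GprimeP_eq_DL2_RS_G {a' : ℝ} (ha' : 0 ≤ a') (g : SiteL2K ℂ 3 (periodsT3 F K) c₀ W₂) :
    DL2 F n K c₀ U₀ (RS F n K hnK c₀ cB U₀ (GprimeP F n K hnK c₀ cB a' U₀ g)) = DL2 F n K c₀ U₀ (RS F n K hnK c₀ cB U₀ (G g)) := by
  rw [RS_GprimeP_eq_RS_G F hnK U₀ Q'' hseq ι T hT G hAG hGA hRS hker ha' g]

end LOD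

end Summit.QuantumFields.YangMills.Theorems.Prop7ZeroModesOrthKerTopMean

end
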